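import Summits.HubbardSuperconductivity.HubbardSuperconductivity.Theorems.AnisotropyChordTransferFibre3FinConvCell

/-!
# Route `AnisotropyChord` / H0 rotor rung: FIN layer 0c — ROW–COLUMN factorised Green tables on a λ-cell (`O(L³)` instead of `O(V²·L)`)

The site tables of the λ-cell resolvent kernel `G̃_λ(r) = (1/V)Σ_{k≠0} cos(k·r)/(2ε(k) − λ)` and of its `ex`-differences
`G̃_λ(r) − G̃_λ(r − ex)`, evaluated by the addition theorem `cos(a + b) = cos a cos b − sin a sin b`:
  `Σ_{k₁,k₂} cos(k₁r₁θ + k₂r₂θ)·w(k) = Σ_{k₁} [cos(k₁r₁θ)·A(k₁,r₂) − sin(k₁r₁θ)·B(k₁,r₂)]`,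
  `A(k₁,r₂) = Σ_{k₂} cos(k₂r₂θ)·w(k₁,k₂)`, `B(k₁,r₂) = Σ_{k₂} sin(k₂r₂θ)·w(k₁,k₂)` (`rc_identity`),
with every sum a ROW DOT PRODUCT of tabulated rows (`…FinConvCell.dot`; trig rows `trigRows`, difference rows `trigDiffRows`,
transposed inner tables `aTabT`, the weight table with its unused `(0,0)` entry zeroed `etZ`), so that a whole `L × L` site
table costs `≈ 4L³` interval products and `O(L³)` list steps (layer 0/0b: `≈ V²` products and `≈ V²·L` steps per table — the
measured bottleneck of the regime certificate at `L = 14`).  Sine enclosures come from the cosine table of modulus `4L`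
(`sinTab`, `mem_sinTab`).  Soundness: `mem_etZ`, `mem_aTabT`, `mem_rcEntry`, ★ `mem_gresRC_cell` (encloses `Gres L λ r` on the
cell), ★ `mem_gdiffRC_cell` (encloses `Gres L λ r − Gres L λ (r − ex)` with the per-row correlation kept: the `k₁`-th term carries
the small factor `cos(k₁r₁θ) − cos(k₁(r₁−1)θ)`).
Prover seat `hubbard-h0-rotor-p3` g4; helper for stmt-HubbardSuperconductivity-23918 (piece A of rung 19089; `--supports`, helper class).
WHAT THIS IS NOT: nothing here proves superconductivity in the Hubbard model; evaluator definitions and enclosure lemmas only (the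
plumbing into the profile/gradient tables of the regime certificate is the next layer). Tree imports only; no sorry.
-/

set_option linter.dupNamespace false
set_option autoImplicit false

noncomputable section

namespace Summit.HubbardSuperconductivity.HubbardSuperconductivity.Theorems.AnisotropyChord.Transfer.Fibre3

namespace FinCell

open scoped BigOperators
open Finset Hole2

variable (L : ℕ) [NeZero L]

/-! ## Layer 0c: the row–column evaluator (computable, zero data) -/

/-- the sine table: `sin(2πm/L) = cos(2π(4m + 3L)/(4L))`. [folklore] -/
def sinTab (L : ℕ) : List Iv := (List.range L).map fun m => cosIv (4 * L) ((4 * m + 3 * L) % (4 * L))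

/-- trig rows: row `r`, entry `k` = `t((k·r) mod L)` from a trig table `tt`. [folklore] -/
def trigRows (L : ℕ) (tt : List Iv) : List (List Iv) :=
  mkTab L fun r k => getIv tt ((k * r) % L)

/-- trig DIFFERENCE rows for the direction `ex`: row `r`, entry `k` = `t(k·r) − t(k·(r−1))`. [folklore] -/
def trigDiffRows (L : ℕ) (tt : List Iv) : List (List Iv) :=
  mkTab L fun r k => isub (getIv tt ((k * r) % L)) (getIv tt ((k * ((r + L - 1) % L)) % L))

/-- zero the head of a row. [folklore] -/
def zeroHead : List Iv → List Iv
  | [] => []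
  | _ :: rest => (0, 0) :: rest

/-- the weight table with the (never meaningful) `(0,0)` entry replaced by the exact zero. [folklore] -/
def etZ : List (List Iv) → List (List Iv)
  | [] => []
  | row0 :: rows => zeroHead row0 :: rows

/-- the transposed inner table: row `r₂`, entry `k₁` = `Σ_{k₂} t(k₂r₂)·w(k₁,k₂)` as a dot product. [folklore] -/
def aTabT (L : ℕ) (trows etz : List (List Iv)) : List (List Iv) :=
  mkTab L fun r2 k1 => dot (trows.getD r2 []) (etz.getD k1 [])

/-- one entry of a row–column sum: `(xr·acol − yr·bcol)/L²`. [folklore] -/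
def rcEntry (L : ℕ) (xr yr acol bcol : List Iv) : Iv :=
  idivn (isub (dot xr acol) (dot yr bcol)) ((L : ℤ) * L)

/-- the site table from row tables `cr`, `sr` (indexed by `r₁`) and transposed inner tables `at`, `bt` (indexed by `r₂`). [folklore] -/
def rcTab (L : ℕ) (cr sr ac bc : List (List Iv)) : List (List Iv) :=
  mkTab L fun r1 r2 => rcEntry L (cr.getD r1 []) (sr.getD r1 []) (ac.getD r2 []) (bc.getD r2 [])

/-- the row–column Green table builder from the trig tables and the cell weight table. [folklore] -/
def rcGreen (L : ℕ) (ct st : List Iv) (et : List (List Iv)) : List (List Iv) :=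
  rcTab L (trigRows L ct) (trigRows L st)
    (aTabT L (trigRows L ct) (etZ et)) (aTabT L (trigRows L st) (etZ et))

/-- the row–column `ex`-difference table builder. [folklore] -/
def rcGreenDiff (L : ℕ) (ct st : List Iv) (et : List (List Iv)) : List (List Iv) :=
  rcTab L (trigDiffRows L ct) (trigDiffRows L st)
    (aTabT L (trigRows L ct) (etZ et)) (aTabT L (trigRows L st) (etZ et))

/-- ★ the cell table of `G̃_λ(r₁,r₂)`, row–column form. [folklore] -/
def gresRCTab (L : ℕ) (la lb : ℤ) : List (List Iv) :=
  rcGreen L (cosTab L) (sinTab L) (gresCellTab L (cosTab L) la lb)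

/-- ★ the cell table of `G̃_λ(r₁,r₂) − G̃_λ(r₁−1,r₂)`, row–column form. [folklore] -/
def gdiffRCTab (L : ℕ) (la lb : ℤ) : List (List Iv) :=
  rcGreenDiff L (cosTab L) (sinTab L) (gresCellTab L (cosTab L) la lb)

/-! ## Trig enclosures -/

variable {L}

omit [NeZero L] in
/-- `sin(2π n/L) = sin(2π (n mod L)/L)`. [folklore] -/
theorem sin_mod (hL : 0 < L) (n : ℕ) :
    Real.sin (2 * Real.pi * n / L) = Real.sin (2 * Real.pi * ((n % L : ℕ) : ℝ) / L) := by
  have hLr : (L : ℝ) ≠ 0 := by exact_mod_cast (ne_of_gt hL)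
  conv_lhs => rw [← Nat.mod_add_div n L]
  rw [show 2 * Real.pi * ((n % L + L * (n / L) : ℕ) : ℝ) / L
      = 2 * Real.pi * ((n % L : ℕ) : ℝ) / L + ((n / L : ℕ) : ℝ) * (2 * Real.pi) by
    push_cast; field_simp]
  exact Real.sin_add_nat_mul_two_pi _ _

omit [NeZero L] in
/-- ★ the sine table encloses `sin(2πm/L)`. [folklore] -/
theorem mem_sinTab (hL : 3 ≤ L) {m : ℕ} (hm : m < L) :
    mem (Real.sin (2 * Real.pi * m / L)) (getIv (sinTab L) m) := by
  have hL4 : 3 ≤ 4 * L := by omega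
  have h4L : 0 < 4 * L := by omega
  unfold sinTab getIv
  rw [getD_map_range _ _ hm]
  have hmod : (4 * m + 3 * L) % (4 * L) < 4 * L := Nat.mod_lt _ h4L
  have h := mem_cosIv hL4 hmod
  rw [show ((4 * L : ℕ) : ℝ) = ((4 * L : ℕ) : ℝ) from rfl] at h
  have hc : Real.cos (2 * Real.pi * (((4 * m + 3 * L) % (4 * L) : ℕ) : ℝ) / ((4 * L : ℕ) : ℝ))
      = Real.sin (2 * Real.pi * m / L) := by
    rw [← cos_mod (4 * L) h4L]
    have hLr : (L : ℝ) ≠ 0 := by exact_mod_cast (show L ≠ 0 by omega)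
    rw [show 2 * Real.pi * ((4 * m + 3 * L : ℕ) : ℝ) / ((4 * L : ℕ) : ℝ)
        = (2 * Real.pi * m / L - Real.pi / 2) + 2 * Real.pi by push_cast; field_simp; ring]
    rw [Real.cos_add_two_pi, Real.cos_sub_pi_div_two]
  rw [hc] at h
  exact h

omit [NeZero L] in
/-- the cosine table encloses `cos(2π k r/L)` at the reduced index. [folklore] -/
theorem mem_cos_kr (hL : 3 ≤ L) (k r : ℕ) :
    mem (Real.cos (2 * Real.pi * ((k * r : ℕ) : ℝ) / L)) (getIv (cosTab L) ((k * r) % L)) := by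
  have hL0 : 0 < L := by omega
  rw [cos_mod L hL0, getIv_cosTab (Nat.mod_lt _ hL0)]
  exact mem_cosIv hL (Nat.mod_lt _ hL0)

omit [NeZero L] in
/-- the sine table encloses `sin(2π k r/L)` at the reduced index. [folklore] -/
theorem mem_sin_kr (hL : 3 ≤ L) (k r : ℕ) :
    mem (Real.sin (2 * Real.pi * ((k * r : ℕ) : ℝ) / L)) (getIv (sinTab L) ((k * r) % L)) := by
  have hL0 : 0 < L := by omega
  rw [sin_mod hL0]
  exact mem_sinTab hL (Nat.mod_lt _ hL0)

/-! ## Table shape lemmas -/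

omit [NeZero L] in
/-- rows of `mkTab` have length `L`. [folklore] -/
theorem length_mkTab_row (g : ℕ → ℕ → Iv) {r : ℕ} (hr : r < L) : ((mkTab L g).getD r []).length = L := by
  rw [mkTab_row g hr, List.length_map, List.length_range]

omit [NeZero L] in
/-- entries of a row of `mkTab` through `getIv`. [folklore] -/
theorem getIv_mkTab_row (g : ℕ → ℕ → Iv) {r k : ℕ} (hr : r < L) (hk : k < L) :
    getIv ((mkTab L g).getD r []) k = g r k := by
  rw [mkTab_row g hr]
  unfold getIv
  exact getD_map_range _ _ hk

omit [NeZero L] in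
/-- `zeroHead` keeps the length. [folklore] -/
theorem length_zeroHead (l : List Iv) : (zeroHead l).length = l.length := by
  cases l <;> rfl

omit [NeZero L] in
/-- entries of `zeroHead`: `(0,0)` at `0`, unchanged after. [folklore] -/
theorem getIv_zeroHead_succ (l : List Iv) (j : ℕ) : getIv (zeroHead l) (j + 1) = getIv l (j + 1) := by
  cases l with
  | nil => rfl
  | cons a rest => simp only [zeroHead, getIv, List.getD_cons_succ]

omit [NeZero L] in
/-- the head of `zeroHead` of a nonempty row. [folklore] -/
theorem getIv_zeroHead_zero (l : List Iv) (hl : l ≠ []) : getIv (zeroHead l) 0 = (0, 0) := by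
  cases l with
  | nil => exact absurd rfl hl
  | cons a rest => simp only [zeroHead, getIv, List.getD_cons_zero]

omit [NeZero L] in
/-- rows of `etZ`: row `0` is `zeroHead` of row `0`, the others unchanged. [folklore] -/
theorem etZ_getD (et : List (List Iv)) (k1 : ℕ) :
    (etZ et).getD k1 [] = if k1 = 0 then zeroHead (et.getD 0 []) else et.getD k1 [] := by
  cases et with
  | nil => cases k1 <;> simp [etZ, zeroHead]
  | cons row0 rows =>
    cases k1 with
    | zero => simp [etZ]
    | succ k => simp [etZ]

/-! ## Enclosures of the factorised sums -/

/-- the zeroed weight: `0` at `k = 0`, `w k` otherwise. [folklore] -/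
noncomputable def wZ (w : ℕ → ℕ → ℝ) (k1 k2 : ℕ) : ℝ := if k1 = 0 ∧ k2 = 0 then 0 else w k1 k2

omit [NeZero L] in
/-- ★ the zeroed table encloses the zeroed weights on the full index range (for a `range`-built `L × L` table). [folklore] -/
theorem mem_etZ (hL : 3 ≤ L) (w : ℕ → ℕ → ℝ) (g : ℕ → ℕ → Iv)
    (hent : ∀ k1 k2 : ℕ, k1 < L → k2 < L → ¬ (k1 = 0 ∧ k2 = 0) → mem (w k1 k2) (getIv ((mkTab L g).getD k1 []) k2))
    {k1 k2 : ℕ} (hk1 : k1 < L) (hk2 : k2 < L) :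
    mem (wZ w k1 k2) (getIv ((etZ (mkTab L g)).getD k1 []) k2) := by
  rw [etZ_getD]
  unfold wZ
  by_cases h1 : k1 = 0
  · subst h1
    rw [if_pos rfl]
    have hne : (mkTab L g).getD 0 [] ≠ [] := by
      intro h
      have := length_mkTab_row g hk1
      rw [h, List.length_nil] at this
      omega
    cases k2 with
    | zero =>
      rw [if_pos ⟨rfl, rfl⟩, getIv_zeroHead_zero _ hne]
      have := mem_exact 0
      push_cast at this
      rw [zero_div] at this
      exact this
    | succ j =>
      rw [if_neg (fun h => by omega), getIv_zeroHead_succ]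
      exact hent 0 (j + 1) hk1 hk2 (fun h => by omega)
  · rw [if_neg h1, if_neg (fun h => h1 h.1)]
    exact hent k1 k2 hk1 hk2 (fun h => h1 h.1)

omit [NeZero L] in
/-- ★ the transposed inner table encloses `Σ_{k₂<L} t(k₂r₂)·wZ(k₁,k₂)`. [folklore] -/
theorem mem_aTabT (hL : 3 ≤ L) (t : ℕ → ℝ) (tt : List Iv) (htt : ∀ k r : ℕ, mem (t (k * r)) (getIv tt ((k * r) % L)))
    (w : ℕ → ℕ → ℝ) (g : ℕ → ℕ → Iv)
    (hent : ∀ k1 k2 : ℕ, k1 < L → k2 < L → ¬ (k1 = 0 ∧ k2 = 0) → mem (w k1 k2) (getIv ((mkTab L g).getD k1 []) k2))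
    {r2 k1 : ℕ} (hr2 : r2 < L) (hk1 : k1 < L) :
    mem (∑ k2 ∈ range L, t (k2 * r2) * wZ w k1 k2)
      (getIv ((aTabT L (trigRows L tt) (etZ (mkTab L g))).getD r2 []) k1) := by
  unfold aTabT
  rw [getIv_mkTab_row _ hr2 hk1]
  have hl1 : ((trigRows L tt).getD r2 []).length = L := by unfold trigRows; exact length_mkTab_row _ hr2
  have hl2 : ((etZ (mkTab L g)).getD k1 []).length = L := by
    rw [etZ_getD]
    split_ifs with h
    · rw [length_zeroHead]; exact length_mkTab_row g (by omega)
    · exact length_mkTab_row g hk1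
  have := mem_dot ((trigRows L tt).getD r2 []) ((etZ (mkTab L g)).getD k1 [])
    (fun k2 => t (k2 * r2)) (fun k2 => wZ w k1 k2) (by rw [hl1, hl2])
    (fun j hj => by
      rw [hl1] at hj
      unfold trigRows
      rw [getIv_mkTab_row _ hr2 hj]
      exact htt j r2)
    (fun j hj => by
      rw [hl2] at hj
      exact mem_etZ hL w g hent hk1 hj)
  rw [hl1] at this
  exact this

omit [NeZero L] in
/-- ★ one row–column entry encloses `(Σ_{k₁<L} (x(k₁)·A(k₁) − y(k₁)·B(k₁)))/L²`. [folklore] -/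
theorem mem_rcEntry (hL : 3 ≤ L) (x y A B : ℕ → ℝ) (xr yr acol bcol : List Iv)
    (hxl : xr.length = L) (hyl : yr.length = L) (hal : acol.length = L) (hbl : bcol.length = L)
    (hx : ∀ j : ℕ, j < L → mem (x j) (getIv xr j)) (hy : ∀ j : ℕ, j < L → mem (y j) (getIv yr j))
    (hA : ∀ j : ℕ, j < L → mem (A j) (getIv acol j)) (hB : ∀ j : ℕ, j < L → mem (B j) (getIv bcol j)) :
    mem ((∑ k1 ∈ range L, (x k1 * A k1 - y k1 * B k1)) / (L : ℝ) ^ 2) (rcEntry L xr yr acol bcol) := by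
  unfold rcEntry
  have hLL : (0 : ℤ) < (L : ℤ) * L := by
    have : (0 : ℤ) < L := by exact_mod_cast (show 0 < L by omega)
    positivity
  have h1 := mem_dot xr acol x A (by rw [hxl, hal]) (fun j hj => hx j (by rw [hxl] at hj; exact hj))
    (fun j hj => hA j (by rw [hal] at hj; exact hj))
  have h2 := mem_dot yr bcol y B (by rw [hyl, hbl]) (fun j hj => hy j (by rw [hyl] at hj; exact hj))
    (fun j hj => hB j (by rw [hbl] at hj; exact hj))
  rw [hxl] at h1
  rw [hyl] at h2
  have h := mem_idivn (mem_isub h1 h2) hLL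
  rw [← Finset.sum_sub_distrib] at h
  push_cast at h
  rw [sq]
  exact h

/-! ## The row–column identity -/

omit [NeZero L] in
/-- the addition theorem inside the double sum: `Σ_{k₁,k₂} wterm = Σ_{k₁} [cos(k₁r₁θ)·A_c(k₁) − sin(k₁r₁θ)·A_s(k₁)]`. [folklore] -/
theorem rc_identity (hL : 0 < L) (w : ℕ → ℕ → ℝ) (r1 r2 : ℕ) :
    ∑ k1 ∈ range L, ∑ k2 ∈ range L, wterm L w r1 r2 k1 k2
      = ∑ k1 ∈ range L,
          (Real.cos (2 * Real.pi * ((k1 * r1 : ℕ) : ℝ) / L) * ∑ k2 ∈ range L, Real.cos (2 * Real.pi * ((k2 * r2 : ℕ) : ℝ) / L) * wZ w k1 k2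
            - Real.sin (2 * Real.pi * ((k1 * r1 : ℕ) : ℝ) / L) * ∑ k2 ∈ range L, Real.sin (2 * Real.pi * ((k2 * r2 : ℕ) : ℝ) / L) * wZ w k1 k2) := by
  refine Finset.sum_congr rfl fun k1 _ => ?_
  rw [Finset.mul_sum, Finset.mul_sum, ← Finset.sum_sub_distrib]
  refine Finset.sum_congr rfl fun k2 _ => ?_
  unfold wterm wZ
  by_cases hk : k1 = 0 ∧ k2 = 0
  · rw [if_pos hk, if_pos hk]; ring
  · rw [if_neg hk, if_neg hk, ← cos_mod L hL]
    rw [show 2 * Real.pi * ((k1 * r1 + k2 * r2 : ℕ) : ℝ) / L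
        = 2 * Real.pi * ((k1 * r1 : ℕ) : ℝ) / L + 2 * Real.pi * ((k2 * r2 : ℕ) : ℝ) / L by push_cast; ring]
    rw [Real.cos_add]
    ring

/-! ## Soundness of the Green tables -/

/-- ★ the row–column table encloses `G̃_λ(r₁,r₂)` on the cell. [folklore] -/
theorem mem_gresRC_cell (hL : 3 ≤ L) {lam : ℝ} {la lb : ℤ}
    (hla : (la : ℝ) ≤ lam * ((D : ℤ) : ℝ)) (hlb : lam * ((D : ℤ) : ℝ) ≤ (lb : ℝ))
    (hpos : denCellPos L (cosTab L) la lb = true) {r1 r2 : ℕ} (hr1 : r1 < L) (hr2 : r2 < L) :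
    mem (Gres L lam (((r1 : ℕ) : ZMod L), ((r2 : ℕ) : ZMod L))) (getF (gresRCTab L la lb) r1 r2) := by
  have hL0 : 0 < L := by omega
  rw [Gres_eq_sum L lam hr1 hr2, rc_identity hL0]
  unfold gresRCTab rcGreen rcTab
  rw [getF_mkTab _ hr1 hr2]
  have hent := mem_gresCellTab L hL hla hlb hpos
  refine mem_rcEntry hL _ _ _ _ _ _ _ _ ?_ ?_ ?_ ?_ (fun j hj => ?_) (fun j hj => ?_) (fun j hj => ?_) (fun j hj => ?_)
  · unfold trigRows; exact length_mkTab_row _ hr1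
  · unfold trigRows; exact length_mkTab_row _ hr1
  · unfold aTabT; exact length_mkTab_row _ hr2
  · unfold aTabT; exact length_mkTab_row _ hr2
  · unfold trigRows; rw [getIv_mkTab_row _ hr1 hj]; exact mem_cos_kr hL j r1
  · unfold trigRows; rw [getIv_mkTab_row _ hr1 hj]; exact mem_sin_kr hL j r1
  · exact mem_aTabT hL (fun n : ℕ => Real.cos (2 * Real.pi * (n : ℝ) / L)) (cosTab L) (fun k r => mem_cos_kr hL k r)
      (gw L lam) _ hent hr2 hj
  · exact mem_aTabT hL (fun n : ℕ => Real.sin (2 * Real.pi * (n : ℝ) / L)) (sinTab L) (fun k r => mem_sin_kr hL k r)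
      (gw L lam) _ hent hr2 hj

/-- ★ the row–column difference table encloses `G̃_λ(r₁,r₂) − G̃_λ(r₁−1,r₂)` on the cell (the `ex`-gradient of the kernel). [folklore] -/
theorem mem_gdiffRC_cell (hL : 3 ≤ L) {lam : ℝ} {la lb : ℤ}
    (hla : (la : ℝ) ≤ lam * ((D : ℤ) : ℝ)) (hlb : lam * ((D : ℤ) : ℝ) ≤ (lb : ℝ))
    (hpos : denCellPos L (cosTab L) la lb = true) {r1 r2 : ℕ} (hr1 : r1 < L) (hr2 : r2 < L) :
    mem (Gres L lam (((r1 : ℕ) : ZMod L), ((r2 : ℕ) : ZMod L))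
          - Gres L lam (((((r1 + L - 1) % L : ℕ)) : ZMod L), ((r2 : ℕ) : ZMod L)))
      (getF (gdiffRCTab L la lb) r1 r2) := by
  have hL0 : 0 < L := by omega
  have hs1 : (r1 + L - 1) % L < L := Nat.mod_lt _ hL0
  rw [Gres_eq_sum L lam hr1 hr2, Gres_eq_sum L lam hs1 hr2, rc_identity hL0, rc_identity hL0, ← sub_div,
    ← Finset.sum_sub_distrib]
  have hre : ∀ k1 : ℕ, k1 ∈ range L →
      (Real.cos (2 * Real.pi * ((k1 * r1 : ℕ) : ℝ) / L) * ∑ k2 ∈ range L, Real.cos (2 * Real.pi * ((k2 * r2 : ℕ) : ℝ) / L) * wZ (gw L lam) k1 k2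
          - Real.sin (2 * Real.pi * ((k1 * r1 : ℕ) : ℝ) / L) * ∑ k2 ∈ range L, Real.sin (2 * Real.pi * ((k2 * r2 : ℕ) : ℝ) / L) * wZ (gw L lam) k1 k2)
        - (Real.cos (2 * Real.pi * ((k1 * ((r1 + L - 1) % L) : ℕ) : ℝ) / L) * ∑ k2 ∈ range L, Real.cos (2 * Real.pi * ((k2 * r2 : ℕ) : ℝ) / L) * wZ (gw L lam) k1 k2
          - Real.sin (2 * Real.pi * ((k1 * ((r1 + L - 1) % L) : ℕ) : ℝ) / L) * ∑ k2 ∈ range L, Real.sin (2 * Real.pi * ((k2 * r2 : ℕ) : ℝ) / L) * wZ (gw L lam) k1 k2)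
      = (Real.cos (2 * Real.pi * ((k1 * r1 : ℕ) : ℝ) / L) - Real.cos (2 * Real.pi * ((k1 * ((r1 + L - 1) % L) : ℕ) : ℝ) / L))
          * ∑ k2 ∈ range L, Real.cos (2 * Real.pi * ((k2 * r2 : ℕ) : ℝ) / L) * wZ (gw L lam) k1 k2
        - (Real.sin (2 * Real.pi * ((k1 * r1 : ℕ) : ℝ) / L) - Real.sin (2 * Real.pi * ((k1 * ((r1 + L - 1) % L) : ℕ) : ℝ) / L))
          * ∑ k2 ∈ range L, Real.sin (2 * Real.pi * ((k2 * r2 : ℕ) : ℝ) / L) * wZ (gw L lam) k1 k2 := by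
    intro k1 _; ring
  rw [Finset.sum_congr rfl hre]
  unfold gdiffRCTab rcGreenDiff rcTab
  rw [getF_mkTab _ hr1 hr2]
  have hent := mem_gresCellTab L hL hla hlb hpos
  refine mem_rcEntry hL _ _ _ _ _ _ _ _ ?_ ?_ ?_ ?_ (fun j hj => ?_) (fun j hj => ?_) (fun j hj => ?_) (fun j hj => ?_)
  · unfold trigDiffRows; exact length_mkTab_row _ hr1
  · unfold trigDiffRows; exact length_mkTab_row _ hr1
  · unfold aTabT; exact length_mkTab_row _ hr2
  · unfold aTabT; exact length_mkTab_row _ hr2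
  · unfold trigDiffRows; rw [getIv_mkTab_row _ hr1 hj]; exact mem_isub (mem_cos_kr hL j r1) (mem_cos_kr hL j _)
  · unfold trigDiffRows; rw [getIv_mkTab_row _ hr1 hj]; exact mem_isub (mem_sin_kr hL j r1) (mem_sin_kr hL j _)
  · exact mem_aTabT hL (fun n : ℕ => Real.cos (2 * Real.pi * (n : ℝ) / L)) (cosTab L) (fun k r => mem_cos_kr hL k r)
      (gw L lam) _ hent hr2 hj
  · exact mem_aTabT hL (fun n : ℕ => Real.sin (2 * Real.pi * (n : ℝ) / L)) (sinTab L) (fun k r => mem_sin_kr hL k r)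
      (gw L lam) _ hent hr2 hj

end FinCell

end Summit.HubbardSuperconductivity.HubbardSuperconductivity.Theorems.AnisotropyChord.Transfer.Fibre3

end
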